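import Literature.Geometry.Riemannian.ThreeShrinkerDegenerateLocalStructure
import Literature.Geometry.Riemannian.GradientSolitonIdentities
import Literature.Geometry.Lorentzian.CoordNullLeafCalculus
import HarnessLib

/-!
# Degenerate three-dimensional gradient solitons: `S = C e^ψ` and the positive lower bound for `S`

The degenerate case of the classification of complete three-dimensional gradient shrinking
Ricci solitons (`threeShrinkerClassification_modelData`; Munteanu–Wang 2016, Thm. 1.2): a
connected three-dimensional gradient soliton `Ric + Hess f = λ g` (`λ ≠ 0`) with `Ric ≥ 0`, `S > 0`
and a null vector of `Ric` somewhere. By `ThreeShrinkerDegenerateLocalStructure` such a soliton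
carries, locally, a parallel unit null field `v`, and `Ric = (S/2)(g − θ⊗θ)`; the two-dimensional
soliton identity `dK = K df_Σ` on the leaves integrates to a GLOBAL statement:

* `scalarCurvature_eq_mul_exp_of_degenerate` — **`S = C e^ψ`** for a constant `C > 0`, where
  `ψ = f − h/(2λ)` and `h = |∇f|² − (2/S) Ric(∇f, ∇f)` (`= df(v)²`, written without `v`): the
  function `log S − ψ` has vanishing differential in every chart
  (`CoordNullLeafCalculus.IsMetricOn.hasFDerivAt_log_scalAt_sub_of_null`), so it is locally
  constant, hence constant on the connected manifold;
* `gradSq_sub_ricci_nonneg_of_degenerate`, `gradSq_sub_ricci_le_gradSq` — `0 ≤ h ≤ |∇f|²`;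
* `exists_pos_le_scalarCurvature_of_degenerate` — **for a NORMALISED shrinker** (`λ = ½`,
  `S + |∇f|² = f`): `ψ = f − h ≥ S`, so `S = C e^ψ ≥ C e^S ≥ C`: the scalar curvature of a
  degenerate normalised three-dimensional shrinker is bounded below by a positive constant (on the
  model `S² × ℝ`, `S ≡ 1`).

This is the input of Myers' theorem on the leaves (compactness of the level surface `{h = 0}`) in
the proof that such a soliton is a quotient of the round cylinder. Everything is proved; no
definitions are introduced.

## References

* O. Munteanu, J. Wang, arXiv:1606.01861, Thm. 1.1, Thm. 1.2 (p. 3). [MunteanuWang2016]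
* P. Petersen, W. Wylie, Geom. Topol. 14 (2010), §3. [PetersenWylie2010]
* R. S. Hamilton, *The Ricci flow on surfaces*, Contemp. Math. 71 (1988), §10. [Hamilton1988]
-/

noncomputable section

set_option maxSynthPendingDepth 3

open Bundle Set Function Filter Module Metric
open scoped Manifold ContDiff Topology

namespace Literature.Geometry.Riemannian

open Lorentzian Lorentzian.PseudoRiemannianMetric

variable {M : Type*} [TopologicalSpace M] [ChartedSpace (EuclideanSpace ℝ (Fin 3)) M]
  [IsManifold (𝓡 3) ∞ M]
  (g : PseudoRiemannianMetric (𝓡 3) ∞ (EuclideanSpace ℝ (Fin 3)) (TangentSpace (𝓡 3) : M → Type _))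
  [g.HasLeviCivita]

/-- **`S = C e^ψ` on a degenerate three-dimensional gradient soliton.** On a connected
three-dimensional gradient soliton `Ric + Hess f = λ g`, `λ ≠ 0`, with `Ric ≥ 0`, `S > 0` and a null
vector of `Ric` at some point, there is a constant `C > 0` with
`S(x) = C · exp (f(x) − h(x)/(2λ))`, `h = |∇f|² − (2/S) Ric(∇f, ∇f)` (`∇f = ♯df`), at every point.
(With the local parallel unit null field `v`: `h = df(v)²`, `Ric = (S/2)(g − θ⊗θ)`,
`dS = 2Ric(∇f,·) = S (df − df(v) θ)` and `d(df(v)) = λθ`, so `d(log S − f + h/(2λ)) = 0` in every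
chart; a locally constant function on a connected manifold is constant.) On the leaves this is the
two-dimensional soliton identity `dK = K df_Σ`, `K = S/2`.
[cite: MunteanuWang2016, Thm. 1.1 and Thm. 1.2 (p. 3)] [cite: PetersenWylie2010, §3]
[cite: Hamilton1988, §10] -/
theorem scalarCurvature_eq_mul_exp_of_degenerate [ConnectedSpace M] (hg : g.IsRiemannian)
    {f : M → ℝ} (hf : ContMDiff (𝓡 3) 𝓘(ℝ, ℝ) ∞ f) {lam : ℝ} (hlam : lam ≠ 0)
    (hsol : ∀ (x : M) (X Y : TangentSpace (𝓡 3) x),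
      g.ricci x X Y + g.hessian f x X Y = lam * g.val x X Y)
    (hRic0 : ∀ (x : M) (w : TangentSpace (𝓡 3) x), 0 ≤ g.ricci x w w)
    (hS : ∀ x, 0 < g.scalarCurvature x) {p : M} {w₀ : TangentSpace (𝓡 3) p} (hw₀ : w₀ ≠ 0)
    (hnull : g.ricci p w₀ w₀ = 0) :
    ∃ C : ℝ, 0 < C ∧ ∀ x : M, g.scalarCurvature x = C * Real.exp (f x -
      (g.gradSq f x - 2 / g.scalarCurvature x *
        g.ricci x (g.sharp x (mvfderiv (𝓡 3) f x : TangentSpace (𝓡 3) x →ₗ[ℝ] ℝ))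
          (g.sharp x (mvfderiv (𝓡 3) f x : TangentSpace (𝓡 3) x →ₗ[ℝ] ℝ))) / (2 * lam)) := by
  have h3 : finrank ℝ (EuclideanSpace ℝ (Fin 3)) = 3 := finrank_euclideanSpace_fin
  -- the function `Q = log S − ψ`
  set Q : M → ℝ := fun x ↦ Real.log (g.scalarCurvature x) - (f x -
      (g.gradSq f x - 2 / g.scalarCurvature x *
        g.ricci x (g.sharp x (mvfderiv (𝓡 3) f x : TangentSpace (𝓡 3) x →ₗ[ℝ] ℝ))
          (g.sharp x (mvfderiv (𝓡 3) f x : TangentSpace (𝓡 3) x →ₗ[ℝ] ℝ))) / (2 * lam)) with hQ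
  -- `Q` is locally constant
  have hloc : IsLocallyConstant Q := by
    refine (IsLocallyConstant.iff_eventually_eq Q).2 fun x₀ ↦ ?_
    -- the chart at `x₀` and the local parallel null field
    set G := chartRep (𝓡 3) (fun _ ↦ g) x₀ 0 with hGdef
    set T : Set (EuclideanSpace ℝ (Fin 3)) := (extChartAt (𝓡 3) x₀).target with hT
    have hTo : IsOpen T := isOpen_extChartAt_target x₀
    have hGm : MetricCoord.IsMetricOn G T :=
      Lorentzian.OpensChart.isMetricOn_repr (val_chartPullback_eq_chartRep (fun _ : ℝ ↦ g) x₀ 0)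
    have hGpos : ∀ y ∈ T, ∀ v : EuclideanSpace ℝ (Fin 3), v ≠ 0 → 0 < G y v v := by
      intro y hy v hv
      rw [hGdef, show y = ((⟨y, hy⟩ : chartTarget (𝓡 3) x₀) : EuclideanSpace ℝ (Fin 3)) from rfl,
        chartRep_apply]
      exact chartPullback_pos g x₀ ⟨y, hy⟩ (fun w hw ↦ hg _ w hw) v hv
    have hu₀T : extChartAt (𝓡 3) x₀ x₀ ∈ T := mem_extChartAt_target x₀
    set u₀ : EuclideanSpace ℝ (Fin 3) := extChartAt (𝓡 3) x₀ x₀ with hu₀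
    set fc : EuclideanSpace ℝ (Fin 3) → ℝ := f ∘ (extChartAt (𝓡 3) x₀).symm with hfc
    have hfcs : ContDiffOn ℝ ∞ fc T := by
      rw [hfc, ← contMDiffOn_iff_contDiffOn]
      exact hf.comp_contMDiffOn (contMDiffOn_extChartAt_symm x₀)
    have hsolc := soliton_chartRep_target g x₀ hf hsol
    have hScal : ∀ y (hy : y ∈ T),
        MetricCoord.scalAt G y = g.scalarCurvature (chartInv (𝓡 3) x₀ ⟨y, hy⟩) := fun y hy ↦
      (Lorentzian.scalarCurvature_chartInv_eq g x₀ ⟨y, hy⟩).symm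
    have hSpos : ∀ y ∈ T, 0 < MetricCoord.scalAt G y := fun y hy ↦ by rw [hScal y hy]; exact hS _
    have hRicc : ∀ y ∈ T, ∀ w : EuclideanSpace ℝ (Fin 3), 0 ≤ MetricCoord.ricAt G y w w := by
      intro y hy w
      have h := hRic0 (chartInv (𝓡 3) x₀ ⟨y, hy⟩)
        (mfderiv 𝓘(ℝ, EuclideanSpace ℝ (Fin 3)) (𝓡 3) (chartInv (𝓡 3) x₀) ⟨y, hy⟩ w)
      rwa [ricci_chartInv_mfderiv_eq_ricAt] at h
    obtain ⟨U, hUo, hu₀U, hUT, v, hvs, hvU, hpar⟩ :=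
      exists_parallel_null_field_chart_of_soliton g hg hf hsol hRic0 hS hw₀ hnull x₀
    have hGU : MetricCoord.IsMetricOn G U := hGm.mono hUo hUT
    have hfcU : ContDiffOn ℝ ∞ fc U := hfcs.mono hUT
    have hsolU : ∀ y ∈ U, ∀ a b, MetricCoord.ricAt G y a b + MetricCoord.hessAt G fc y a b =
        lam * G y a b := fun y hy ↦ hsolc y (hUT hy)
    have hnullU : ∀ z ∈ U, ∀ Z, MetricCoord.ricAt G z (v z) Z = 0 := fun z hz ↦ (hvU z hz).2
    -- `Ric = (S/2)(G − θ⊗θ)` on `U`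
    have hRicU : ∀ z ∈ U, ∀ W Z, MetricCoord.ricAt G z W Z =
        MetricCoord.scalAt G z / 2 * (G z W Z - G z (v z) W * G z (v z) Z) := by
      intro z hz W Z
      have hzT := hUT hz
      have hvz : v z ≠ 0 := by
        intro h0
        have h1 := (hvU z hz).1
        rw [h0] at h1
        simp at h1
      obtain ⟨e, a, ha, he, hμ⟩ := hGm.exists_null_eigenframe_of_null hzT h3 hGpos hfcs hsolc hRicc
        (hSpos z hzT) hvz ((hvU z hz).2 (v z))
      exact hGU.ricAt_eq_of_unit_null e he ha hμ (hvU z hz).1 (hvU z hz).2 hz W Z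
    -- the chart expression `Qc` of `Q` has vanishing derivative on `U`
    set Qc : EuclideanSpace ℝ (Fin 3) → ℝ := fun z ↦ Real.log (MetricCoord.scalAt G z) -
      (fc z - (fderiv ℝ fc z (v z)) ^ 2 / (2 * lam)) with hQc
    have hQcd : ∀ z ∈ U, HasFDerivAt Qc (0 : EuclideanSpace ℝ (Fin 3) →L[ℝ] ℝ) z := fun z hz ↦
      hGU.hasFDerivAt_log_scalAt_sub_of_null hfcU hsolU hvs hpar hnullU hRicU hz hlam
        (hSpos z (hUT hz))
    -- `Q ∘ Φ = Qc` on `U`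
    have hQΦ : ∀ z (hz : z ∈ U), Q (chartInv (𝓡 3) x₀ ⟨z, hUT hz⟩) = Qc z := by
      intro z hz
      have hzT := hUT hz
      have hfd : MDifferentiableAt (𝓡 3) 𝓘(ℝ, ℝ) f (chartInv (𝓡 3) x₀ ⟨z, hzT⟩) :=
        hf.mdifferentiableAt (by simp)
      have hgrad := gradSq_chartInv_eq g x₀ ⟨z, hzT⟩ (F := f) hfd
      have hsharp := mfderiv_chartInv_sharpAt_eq g x₀ ⟨z, hzT⟩ (F := f) hfd
      have hric : g.ricci (chartInv (𝓡 3) x₀ ⟨z, hzT⟩)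
          (g.sharp (chartInv (𝓡 3) x₀ ⟨z, hzT⟩) (mvfderiv (𝓡 3) f (chartInv (𝓡 3) x₀ ⟨z, hzT⟩) :
            TangentSpace (𝓡 3) (chartInv (𝓡 3) x₀ ⟨z, hzT⟩) →ₗ[ℝ] ℝ))
          (g.sharp (chartInv (𝓡 3) x₀ ⟨z, hzT⟩) (mvfderiv (𝓡 3) f (chartInv (𝓡 3) x₀ ⟨z, hzT⟩) :
            TangentSpace (𝓡 3) (chartInv (𝓡 3) x₀ ⟨z, hzT⟩) →ₗ[ℝ] ℝ)) =
          MetricCoord.ricAt G z (MetricCoord.sharpAt G z (fderiv ℝ fc z))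
            (MetricCoord.sharpAt G z (fderiv ℝ fc z)) := by
        rw [← hsharp, ricci_chartInv_mfderiv_eq_ricAt]
      have hsq := hGU.gradSqAt_sub_eq_sq_of_null (f := fc) (v := v) hRicU hz (hSpos z hzT).ne'
      have hfz : f (chartInv (𝓡 3) x₀ ⟨z, hzT⟩) = fc z := rfl
      simp only [hQ, hQc]
      rw [← hScal z hzT, hfz, hgrad, hric]
      change Real.log (MetricCoord.scalAt G z) - (fc z - (MetricCoord.gradSqAt G fc z -
        2 / MetricCoord.scalAt G z * MetricCoord.ricAt G z (MetricCoord.sharpAt G z (fderiv ℝ fc z))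
          (MetricCoord.sharpAt G z (fderiv ℝ fc z))) / (2 * lam)) = _
      rw [hsq]
    -- `Qc` is constant on a ball `B ⊆ U` around `u₀`
    obtain ⟨r, hr, hrU⟩ := Metric.isOpen_iff.mp hUo u₀ hu₀U
    have hconst : ∀ z ∈ ball u₀ r, Qc z = Qc u₀ := by
      intro z hz
      have hdiff : DifferentiableOn ℝ Qc (ball u₀ r) := fun y hy ↦
        (hQcd y (hrU hy)).differentiableAt.differentiableWithinAt
      have hzero : (ball u₀ r).EqOn (fderiv ℝ Qc) 0 := fun y hy ↦ (hQcd y (hrU hy)).fderiv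
      exact isOpen_ball.is_const_of_fderiv_eq_zero (convex_ball u₀ r).isPreconnected hdiff hzero
        hz (mem_ball_self hr)
    -- back on the manifold
    have h1 : ∀ᶠ x in 𝓝 x₀, extChartAt (𝓡 3) x₀ x ∈ ball u₀ r :=
      (continuousAt_extChartAt (I := 𝓡 3) x₀).eventually (isOpen_ball.mem_nhds (mem_ball_self hr))
    filter_upwards [h1, extChartAt_source_mem_nhds (I := 𝓡 3) x₀] with x hx hxs
    set y := extChartAt (𝓡 3) x₀ x with hydef
    have hyU : y ∈ U := hrU hx
    have hxy : chartInv (𝓡 3) x₀ ⟨y, hUT hyU⟩ = x := (extChartAt (𝓡 3) x₀).left_inv hxs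
    have hx₀ : chartInv (𝓡 3) x₀ ⟨u₀, hUT hu₀U⟩ = x₀ := extChartAt_to_inv x₀
    have e1 : Q x = Qc y := by have h := hQΦ y hyU; rwa [hxy] at h
    have e2 : Q x₀ = Qc u₀ := by have h := hQΦ u₀ hu₀U; rwa [hx₀] at h
    rw [e1, e2, hconst y hx]
  -- hence constant, `Q = log C`
  obtain ⟨p₀⟩ : Nonempty M := ⟨p⟩
  refine ⟨Real.exp (Q p₀), Real.exp_pos _, fun x ↦ ?_⟩
  have hQx : Q x = Q p₀ := hloc.apply_eq_of_preconnectedSpace x p₀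
  have hSx := hS x
  have hlog : Real.log (g.scalarCurvature x) = Q p₀ + (f x -
      (g.gradSq f x - 2 / g.scalarCurvature x *
        g.ricci x (g.sharp x (mvfderiv (𝓡 3) f x : TangentSpace (𝓡 3) x →ₗ[ℝ] ℝ))
          (g.sharp x (mvfderiv (𝓡 3) f x : TangentSpace (𝓡 3) x →ₗ[ℝ] ℝ))) / (2 * lam)) := by
    rw [← hQx]; simp only [hQ]; ring
  rw [← Real.exp_add, ← hlog, Real.exp_log hSx]

/-- **`0 ≤ h`**, `h = |∇f|² − (2/S) Ric(∇f,∇f)`: in a chart with the local parallel null field,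
`h = df(v)²`. [cite: PetersenWylie2010, §3] -/
theorem gradSq_sub_ricci_nonneg_of_degenerate [ConnectedSpace M] (hg : g.IsRiemannian)
    {f : M → ℝ} (hf : ContMDiff (𝓡 3) 𝓘(ℝ, ℝ) ∞ f) {lam : ℝ}
    (hsol : ∀ (x : M) (X Y : TangentSpace (𝓡 3) x),
      g.ricci x X Y + g.hessian f x X Y = lam * g.val x X Y)
    (hRic0 : ∀ (x : M) (w : TangentSpace (𝓡 3) x), 0 ≤ g.ricci x w w)
    (hS : ∀ x, 0 < g.scalarCurvature x) {p : M} {w₀ : TangentSpace (𝓡 3) p} (hw₀ : w₀ ≠ 0)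
    (hnull : g.ricci p w₀ w₀ = 0) (x : M) :
    0 ≤ g.gradSq f x - 2 / g.scalarCurvature x *
        g.ricci x (g.sharp x (mvfderiv (𝓡 3) f x : TangentSpace (𝓡 3) x →ₗ[ℝ] ℝ))
          (g.sharp x (mvfderiv (𝓡 3) f x : TangentSpace (𝓡 3) x →ₗ[ℝ] ℝ)) := by
  have h3 : finrank ℝ (EuclideanSpace ℝ (Fin 3)) = 3 := finrank_euclideanSpace_fin
  set G := chartRep (𝓡 3) (fun _ ↦ g) x 0 with hGdef
  set T : Set (EuclideanSpace ℝ (Fin 3)) := (extChartAt (𝓡 3) x).target with hT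
  have hGm : MetricCoord.IsMetricOn G T :=
    Lorentzian.OpensChart.isMetricOn_repr (val_chartPullback_eq_chartRep (fun _ : ℝ ↦ g) x 0)
  have hGpos : ∀ y ∈ T, ∀ v : EuclideanSpace ℝ (Fin 3), v ≠ 0 → 0 < G y v v := by
    intro y hy v hv
    rw [hGdef, show y = ((⟨y, hy⟩ : chartTarget (𝓡 3) x) : EuclideanSpace ℝ (Fin 3)) from rfl,
      chartRep_apply]
    exact chartPullback_pos g x ⟨y, hy⟩ (fun w hw ↦ hg _ w hw) v hv
  have hu₀T : extChartAt (𝓡 3) x x ∈ T := mem_extChartAt_target x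
  set u₀ : EuclideanSpace ℝ (Fin 3) := extChartAt (𝓡 3) x x with hu₀
  set fc : EuclideanSpace ℝ (Fin 3) → ℝ := f ∘ (extChartAt (𝓡 3) x).symm with hfc
  have hfcs : ContDiffOn ℝ ∞ fc T := by
    rw [hfc, ← contMDiffOn_iff_contDiffOn]
    exact hf.comp_contMDiffOn (contMDiffOn_extChartAt_symm x)
  have hsolc := soliton_chartRep_target g x hf hsol
  have hScal : ∀ y (hy : y ∈ T),
      MetricCoord.scalAt G y = g.scalarCurvature (chartInv (𝓡 3) x ⟨y, hy⟩) := fun y hy ↦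
    (Lorentzian.scalarCurvature_chartInv_eq g x ⟨y, hy⟩).symm
  have hSpos : ∀ y ∈ T, 0 < MetricCoord.scalAt G y := fun y hy ↦ by rw [hScal y hy]; exact hS _
  have hRicc : ∀ y ∈ T, ∀ w : EuclideanSpace ℝ (Fin 3), 0 ≤ MetricCoord.ricAt G y w w := by
    intro y hy w
    have h := hRic0 (chartInv (𝓡 3) x ⟨y, hy⟩)
      (mfderiv 𝓘(ℝ, EuclideanSpace ℝ (Fin 3)) (𝓡 3) (chartInv (𝓡 3) x) ⟨y, hy⟩ w)
    rwa [ricci_chartInv_mfderiv_eq_ricAt] at h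
  obtain ⟨U, hUo, hu₀U, hUT, v, hvs, hvU, hpar⟩ :=
    exists_parallel_null_field_chart_of_soliton g hg hf hsol hRic0 hS hw₀ hnull x
  have hGU : MetricCoord.IsMetricOn G U := hGm.mono hUo hUT
  have hvz : v u₀ ≠ 0 := by
    intro h0
    have h1 := (hvU u₀ hu₀U).1
    rw [h0] at h1
    simp at h1
  obtain ⟨e, a, ha, he, hμ⟩ := hGm.exists_null_eigenframe_of_null hu₀T h3 hGpos hfcs hsolc hRicc
    (hSpos u₀ hu₀T) hvz ((hvU u₀ hu₀U).2 (v u₀))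
  have hRicU : ∀ z ∈ ({u₀} : Set (EuclideanSpace ℝ (Fin 3))), ∀ W Z, MetricCoord.ricAt G z W Z =
      MetricCoord.scalAt G z / 2 * (G z W Z - G z (v z) W * G z (v z) Z) := by
    intro z hz W Z
    rw [mem_singleton_iff] at hz
    subst hz
    exact hGU.ricAt_eq_of_unit_null e he ha hμ (hvU _ hu₀U).1 (hvU _ hu₀U).2 hu₀U W Z
  -- read `h(x)` in the chart at `u₀`
  have hx₀ : chartInv (𝓡 3) x ⟨u₀, hu₀T⟩ = x := extChartAt_to_inv x
  have hfd : MDifferentiableAt (𝓡 3) 𝓘(ℝ, ℝ) f (chartInv (𝓡 3) x ⟨u₀, hu₀T⟩) :=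
    hf.mdifferentiableAt (by simp)
  have hgrad := gradSq_chartInv_eq g x ⟨u₀, hu₀T⟩ (F := f) hfd
  have hsharp := mfderiv_chartInv_sharpAt_eq g x ⟨u₀, hu₀T⟩ (F := f) hfd
  have hric : g.ricci (chartInv (𝓡 3) x ⟨u₀, hu₀T⟩)
      (g.sharp (chartInv (𝓡 3) x ⟨u₀, hu₀T⟩) (mvfderiv (𝓡 3) f (chartInv (𝓡 3) x ⟨u₀, hu₀T⟩) :
        TangentSpace (𝓡 3) (chartInv (𝓡 3) x ⟨u₀, hu₀T⟩) →ₗ[ℝ] ℝ))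
      (g.sharp (chartInv (𝓡 3) x ⟨u₀, hu₀T⟩) (mvfderiv (𝓡 3) f (chartInv (𝓡 3) x ⟨u₀, hu₀T⟩) :
        TangentSpace (𝓡 3) (chartInv (𝓡 3) x ⟨u₀, hu₀T⟩) →ₗ[ℝ] ℝ)) =
      MetricCoord.ricAt G u₀ (MetricCoord.sharpAt G u₀ (fderiv ℝ fc u₀))
        (MetricCoord.sharpAt G u₀ (fderiv ℝ fc u₀)) := by
    rw [← hsharp, ricci_chartInv_mfderiv_eq_ricAt]
  -- the pointwise identity at `u₀` (the metric structure on `T`, the formula at the point `u₀`)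
  have hsq : MetricCoord.gradSqAt G fc u₀ - 2 / MetricCoord.scalAt G u₀ *
      MetricCoord.ricAt G u₀ (MetricCoord.sharpAt G u₀ (fderiv ℝ fc u₀))
        (MetricCoord.sharpAt G u₀ (fderiv ℝ fc u₀)) = (fderiv ℝ fc u₀ (v u₀)) ^ 2 := by
    have hi := hGm.isInvertible u₀ hu₀T
    rw [hRicU u₀ rfl, MetricCoord.apply_sharpAt_apply hi,
      hGm.symm u₀ hu₀T (v u₀) (MetricCoord.sharpAt G u₀ (fderiv ℝ fc u₀)),
      MetricCoord.apply_sharpAt_apply hi, MetricCoord.gradSqAt_apply]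
    field_simp [(hSpos u₀ hu₀T).ne']
    ring
  rw [← hx₀, hgrad, hric, ← hScal u₀ hu₀T]
  change 0 ≤ MetricCoord.gradSqAt G fc u₀ - 2 / MetricCoord.scalAt G u₀ *
      MetricCoord.ricAt G u₀ (MetricCoord.sharpAt G u₀ (fderiv ℝ fc u₀))
        (MetricCoord.sharpAt G u₀ (fderiv ℝ fc u₀))
  rw [hsq]
  exact sq_nonneg _

omit [g.HasLeviCivita] in
/-- **`h ≤ |∇f|²`** (`(2/S) Ric(∇f, ∇f) ≥ 0` when `Ric ≥ 0`, `S > 0`). [folklore] -/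
theorem gradSq_sub_ricci_le_gradSq [g.HasLeviCivita] {f : M → ℝ}
    (hRic0 : ∀ (x : M) (w : TangentSpace (𝓡 3) x), 0 ≤ g.ricci x w w)
    (hS : ∀ x, 0 < g.scalarCurvature x) (x : M) :
    g.gradSq f x - 2 / g.scalarCurvature x *
        g.ricci x (g.sharp x (mvfderiv (𝓡 3) f x : TangentSpace (𝓡 3) x →ₗ[ℝ] ℝ))
          (g.sharp x (mvfderiv (𝓡 3) f x : TangentSpace (𝓡 3) x →ₗ[ℝ] ℝ)) ≤ g.gradSq f x := by
  have h1 : 0 ≤ 2 / g.scalarCurvature x *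
      g.ricci x (g.sharp x (mvfderiv (𝓡 3) f x : TangentSpace (𝓡 3) x →ₗ[ℝ] ℝ))
        (g.sharp x (mvfderiv (𝓡 3) f x : TangentSpace (𝓡 3) x →ₗ[ℝ] ℝ)) :=
    mul_nonneg (div_nonneg zero_le_two (hS x).le) (hRic0 x _)
  linarith

/-- **The scalar curvature of a degenerate normalised three-dimensional shrinker is bounded below
by a positive constant.** On a connected normalised gradient shrinking soliton
(`Ric + Hess f = ½ g`, `S + |∇f|² = f`) of dimension three with `Ric ≥ 0`, `S > 0` and a null
vector of `Ric` at some point: `∃ C > 0, ∀ x, C ≤ S(x)`. Indeed `S = C e^{f − h}` with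
`f − h ≥ f − |∇f|² = S ≥ 0`. (On the model `S²(√2) × ℝ`: `S ≡ 1`.)
[cite: MunteanuWang2016, Thm. 1.2 (p. 3)] [cite: Hamilton1988, §10] -/
theorem exists_pos_le_scalarCurvature_of_degenerate [ConnectedSpace M] (hg : g.IsRiemannian)
    {f : M → ℝ} (hf : ContMDiff (𝓡 3) 𝓘(ℝ, ℝ) ∞ f)
    (hsol : ∀ (x : M) (X Y : TangentSpace (𝓡 3) x),
      g.ricci x X Y + g.hessian f x X Y = (1 / 2 : ℝ) * g.val x X Y)
    (hnorm : ∀ x : M, g.scalarCurvature x + g.gradSq f x = f x)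
    (hRic0 : ∀ (x : M) (w : TangentSpace (𝓡 3) x), 0 ≤ g.ricci x w w)
    (hS : ∀ x, 0 < g.scalarCurvature x) {p : M} {w₀ : TangentSpace (𝓡 3) p} (hw₀ : w₀ ≠ 0)
    (hnull : g.ricci p w₀ w₀ = 0) :
    ∃ C : ℝ, 0 < C ∧ ∀ x : M, C ≤ g.scalarCurvature x := by
  obtain ⟨C, hC, hSC⟩ := scalarCurvature_eq_mul_exp_of_degenerate g hg hf (by norm_num) hsol hRic0
    hS hw₀ hnull
  refine ⟨C, hC, fun x ↦ ?_⟩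
  have hle := gradSq_sub_ricci_le_gradSq g hRic0 hS x (f := f)
  have hexp : (1 : ℝ) ≤ Real.exp (f x -
      (g.gradSq f x - 2 / g.scalarCurvature x *
        g.ricci x (g.sharp x (mvfderiv (𝓡 3) f x : TangentSpace (𝓡 3) x →ₗ[ℝ] ℝ))
          (g.sharp x (mvfderiv (𝓡 3) f x : TangentSpace (𝓡 3) x →ₗ[ℝ] ℝ))) / (2 * (1 / 2))) := by
    rw [show (2 : ℝ) * (1 / 2) = 1 by norm_num, div_one]
    refine Real.one_le_exp ?_
    have := hnorm x
    have := (hS x).le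
    linarith
  calc C = C * 1 := (mul_one C).symm
    _ ≤ C * Real.exp _ := mul_le_mul_of_nonneg_left hexp hC.le
    _ = g.scalarCurvature x := (hSC x).symm

end Literature.Geometry.Riemannian

end
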